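import Summits.ABC.IUTFork.Charitable.Thm311D2
import HarnessLib

/-!
# [IUTchIII] Theorem 3.11, charitable re-typing D2 — census row (R1b): THE ISO-RUNG, NAMED (`HOME/plan/D2/CHARITY-D2.md` §10)

Record-only companion (D-0012) of `Charitable/Thm311D2.lean` (team D2's typing of record `Thm311Charitable_2`, p428473 → p429714),
abc-iut cell, seat abc-iut-D2-typ (gen 4, team anchor), branch D of B/C/D/E, rung LADDER-ABC:A2.D. TAKES NO SIDE on [IUTchIII] Cor. 3.12
or on any author. NO `Prop` FACT: the three `def … : Prop` below are READING PREDICATES over the pinned carriers, never asserted, and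
NOT conjuncts of `Thm311Charitable_2`; the theorems are implications between readings. Typed ≠ proved. Source: S. Mochizuki,
*Inter-universal Teichmüller theory III*, kurims manuscript (May 2020) = `paper:url-4b091feeb646`, read in the cell's render
`HOME/lit/renders/IUTchIII-kurims-url-4b091feeb646/pNNNN.txt` ("p. N l. k") and the VERBATIM packs `HOME/lit/THM311-VERBATIM-BLIND.md`,
`RMK3111-VERBATIM.md`, `IUTchIII-PROP12-RMK122-VERBATIM.md`, `COR312-PROOF-STEPS-X-XII-VERBATIM.md`. [claim: Mochizuki2012, status: disputed]

OCCASION. The team's post-verdict rung census (CHARITY-D2.md §9, anchor ruling 2026-08-26T08:16Z) classified «the square modulo a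
group `G` with `⟨(Ind1)∪(Ind2)⟩ < G ≤ PacketAut`» with a kernel column covering only groups containing a NON-isometric transport
(the model of record's `x ↦ q^{1−j²}·x`, `Thm311D2Countermodel` p430059). The group of column-`n` ADMISSIBILITY- AND
LOG-VOLUME-PRESERVING packet automorphisms (`IsoAdmAt S n`) contains `⟨(Ind1)∪(Ind2)⟩` (given (i) (a): `isoAdmAt_of_mem_closure`) and
excludes that transport whenever `|log q| > 0`; ANCHOR RULING #2 (HOME/STATUS.md 2026-08-26T09:16:17Z) records it as census row (R1b)
and team D2-prv's proof-only file `Charitable/Thm311D2GroupLadder.lean` as its kernel column (the rung ⊢ the typed inequality by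
volumes; refuted on honestly `j²`-scaled pin-respecting settings; ⊬ `S` conjecturally). This file NAMES the rung so that it can be
graded and cited: `III_c_KummerLinkSquareIso` (datum form, Theorem-3.11 vocabulary, no `ρ`) and `III_c_IsoTransportRegion` (region
form, through the pins' region reading `ρ` — the form the ladder consumes), and proves that the rung is a WEAKENING of the
load-bearing clause `III_c_KummerLinkSquare` in the group parameter only (`kummerLinkSquareIso_of_square`,
`isoTransportRegion_of_square`, `isoTransportRegion_of_charitable_2`); its LEVEL (an identification at the q-corner) is unchanged.

PRINT, FOR reading T20's "up to the indeterminacies (Ind1), (Ind2)" (p. 158 l. 5–15) through ISOMETRY rather than through words in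
the generators: (Ind2) is DEFINED via "the action of independent copies of Ism [cf. Proposition 1.2, (vi)]" (p. 154 l. 55–63);
Prop. 1.2 (vi), p. 32 l. 40–72: "a natural functorial algorithm … for constructing an Ism-orbit of isomorphisms `log(†𝒟⊢_v) ⥲
log(†𝔉⊢×μ_v)` … The various isomorphisms of the last two displays are compatible with one another, … the respective log-shells, and the
respective log-volumes on these log-shells", (vii) p. 33 l. 13–45 (archimedean: "compatible with … the respective angular and radial
log-volumes"); (Ind1) acts through "the automorphisms of the procession of 𝒟⊢-prime-strips" (p. 154 l. 52–54) and the log-volume is "a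
functorial algorithm from the 𝒟⊢-prime-strips" (Prop. 3.9 (ii), p. 116 l. 28 – p. 117 l. 7) — so every (Ind1)/(Ind2) generator
preserves admissibility and log-volume (clause `I_a_IndInvariant`, typed PLAIN); and the printed PROOF of Cor. 3.12 consumes exactly this
property of the indeterminacies and no other: Step (x), p. 181 l. 8–12, "[one verifies immediately — cf. Proposition 3.9, (ii) — that]
the resulting log-volumes ∈ ℝ are invariant with respect to the indeterminacies (Ind1), (Ind2), and have the effect of converting the
indeterminacy (Ind3) into an inequality [from above]"; Step (x), p. 180 l. 52–56, glosses (Ind2) as "arising from the requirement of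
compatibility with the Aut_{𝔉⊢×μ}(−)-indeterminacies that act on the domain/codomain of the Θ×μ_LGP-link [cf. (ii); Theorem 3.11, (i),
(iii)], i.e., with the horizontal arrows of the log-theta-lattice". PRINT, AGAINST: the level is unchanged, so against the sense print
fixes for T20 at Rmk. 3.11.4 (i), p. 172 l. 34–41 ("invisible" indeterminacies, domain-side) the rung is still datum-level; and Rmk.
3.11.1 (viii), p. 166 l. 16–30 ("the value group portions … are held rigid [i.e., are not subject to indeterminacies]") with Cor. 3.12
Step (ii), p. 175 l. 50–62 ("the cyclotomes … which give rise to the 'value group portion' `⁰’⁰𝔉⊩▶_LGP`, are insulated from these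
Aut_{𝔉⊢×μ}(−)-indeterminacies") admit NO indeterminacy at the value-group datum, isometric or not (under print's sense the corner is
naked: `Thm311D2Derive` §11 `square_iff_naked_of_indNoEffect`). CLASS (typer's column; the grade is the referees'): DIAGNOSTIC — §9's
answer («no print-located S-rung strictly between the hull rung and the datum square») is unchanged; the rung serves to show in the
kernel that the located residual is VOLUMETRIC (honest `j²`-scaling vs `|log q| > 0`), not a matter of the indeterminacy group's size.
Nothing asserted; locates / conditionally verifies; typed ≠ proved.
-/

noncomputable section

open Set

namespace Summit.ABC.IUTFork.Charitable.D2

open Thm311 Cor312 Cor312Vol Literature.IUT.LogThetaLattice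

variable {T : ThetaIndex} (S : LatticeSituation T)

/-! ## 1. The three reading predicates -/

/-- **`IsoAdmAt S n Φ` — `Φ` is a column-`n` ADMISSIBILITY- AND LOG-VOLUME-PRESERVING packet automorphism** ("isometry" of the
mono-analytic containers for the procession-normalized mono-analytic log-volume of (i) (a) / Prop. 3.9 (ii)): at every `(j, v_ℚ)`,
`B` is admissible iff `Φ·B` is, and then `μ^log(Φ·B) = μ^log(B)`. The property print attributes to (Ind1) (functoriality in the
𝒟⊢-prime-strips, p. 154 l. 52–54 with Prop. 3.9 (ii) p. 116 l. 28 – p. 117 l. 7) and to (Ind2) ("Ism", p. 154 l. 55–63 with Prop. 1.2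
(vi) p. 32 l. 40–72, (vii) p. 33 l. 13–45), and the ONLY property of them that Cor. 3.12 Step (x) p. 181 l. 8–12 uses. The set
`{Φ | IsoAdmAt S n Φ}` is a subgroup of `PacketAut` (`isoAdmAt_one/mul/inv`) containing `⟨(Ind1)∪(Ind2)⟩` under `I_a_IndInvariant`
(`isoAdmAt_of_mem_closure`). READING PREDICATE, never asserted. [claim: Mochizuki2012, status: disputed] -/
@[claim "Mochizuki2012" "disputed"]
def IsoAdmAt (n : ℤ) (Φ : S.L.PacketAut) : Prop :=
  ∀ (j : T.Label) (vQ : T.VQ) (B : Set (S.L.Packet j vQ)),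
    ((S.D n).Adm j vQ B ↔ (S.D n).Adm j vQ (Φ j vQ '' B)) ∧
      ((S.D n).Adm j vQ B → (S.D n).logvol j vQ (Φ j vQ '' B) = (S.D n).logvol j vQ B)

/-- **(R1b), DATUM FORM — `III_c_KummerLinkSquareIso`: the load-bearing square of (iii) (c)'s final sentence (p. 158 l. 5–15) with
"up to (Ind1), (Ind2)" read as "up to ONE column-`n` isometry"** (CHARITY-D2.md §10): `qK = Φ·Ψ^{Frob}_{(n−1,m)}` for SOME `Φ` with
`IsoAdmAt S n Φ` and SOME row `m` ((Ind3)). Weaker than `III_c_KummerLinkSquare` in the group parameter only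
(`kummerLinkSquareIso_of_square`); same LEVEL (an identification of the codomain strip's q-datum `qK`, binder reading of
`Thm311D2`'s module docstring). Print FOR / AGAINST: this file's module docstring (FOR: p. 154 l. 55–63, Prop. 1.2 (vi)/(vii), Prop. 3.9
(ii), Step (x) p. 181 l. 8–12 and p. 180 l. 52–56; AGAINST: Rmk. 3.11.4 (i) p. 172 l. 34–41, Rmk. 3.11.1 (viii) p. 166 l. 16–30, Step (ii)
p. 175 l. 50–62). NOT a conjunct of `Thm311Charitable_2`. READING PREDICATE, never asserted. [claim: Mochizuki2012, status: disputed] -/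
@[claim "Mochizuki2012" "disputed"]
def III_c_KummerLinkSquareIso (n : ℤ) (qK : ∀ v : T.V, v ∈ T.Vbad → Set (S.L.StarPacket v)) : Prop :=
  ∃ Φ : S.L.PacketAut, IsoAdmAt S n Φ ∧ ∃ m : ℤ,
    ∀ (v : T.V) (hv : v ∈ T.Vbad), qK v hv = S.L.starAut Φ v '' (S.col (n - 1)).frobΨ m v hv

/-- **(R1b), REGION FORM — `III_c_IsoTransportRegion`: the ISO-RUNG read through the pins' region operator `ρ`** (team D2-prv's
«ISO-RUNG», HOME/plan/D2/HANDOFF-D2.md 2026-08-26T08:50:51Z): in every packet `(j, v_ℚ)` the `ρ`-region of `qK` is the translate, by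
ONE column-`n` isometry `Φ` (`IsoAdmAt S n Φ`), of the `ρ`-region of the previous column's Frobenius-like splitting monoid at some row
`m`. Follows from the datum form for `Φ`-equivariant `ρ`, hence from `III_c_KummerLinkSquare` under (i) (a) and the pins'
(hρ)-equivariance inside `⟨(Ind1)∪(Ind2)⟩` (`isoTransportRegion_of_square`); stated with `ρ` because (hρ) grants equivariance for
closure elements only. A reading at the level of the Corollary's region operator (like `S := PilotKummerIndRelated` itself), NOT a
conjunct of `Thm311Charitable_2`. READING PREDICATE, never asserted. [claim: Mochizuki2012, status: disputed] -/
@[claim "Mochizuki2012" "disputed"]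
def III_c_IsoTransportRegion (n : ℤ)
    (ρ : (∀ v : T.V, v ∈ T.Vbad → Set (S.L.StarPacket v)) → ∀ (j : T.Label) (vQ : T.VQ), Set (S.L.Packet j vQ))
    (qK : ∀ v : T.V, v ∈ T.Vbad → Set (S.L.StarPacket v)) : Prop :=
  ∃ Φ : S.L.PacketAut, IsoAdmAt S n Φ ∧ ∃ m : ℤ,
    ∀ (j : T.Label) (vQ : T.VQ), ρ qK j vQ = Φ j vQ '' ρ ((S.col (n - 1)).frobΨ m) j vQ

/-! ## 2. The isometries form a subgroup containing `⟨(Ind1)∪(Ind2)⟩` (given (i) (a)) -/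

/-- The identity is a column-`n` isometry. [folklore] -/
theorem isoAdmAt_one (n : ℤ) : IsoAdmAt S n 1 := by
  intro j vQ B
  simp

/-- Column-`n` isometries are closed under composition. [folklore] -/
theorem isoAdmAt_mul {n : ℤ} {Φ Ψ : S.L.PacketAut} (hΦ : IsoAdmAt S n Φ) (hΨ : IsoAdmAt S n Ψ) :
    IsoAdmAt S n (Φ * Ψ) := by
  intro j vQ B
  have hcomp : ⇑((Φ * Ψ) j vQ) = ⇑(Φ j vQ) ∘ ⇑(Ψ j vQ) := by
    funext x
    rfl
  rw [hcomp, Set.image_comp]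
  refine ⟨(hΨ j vQ B).1.trans (hΦ j vQ _).1, fun hB => ?_⟩
  rw [(hΦ j vQ _).2 ((hΨ j vQ B).1.mp hB), (hΨ j vQ B).2 hB]

/-- Column-`n` isometries are closed under inversion. [folklore] -/
theorem isoAdmAt_inv {n : ℤ} {Φ : S.L.PacketAut} (hΦ : IsoAdmAt S n Φ) : IsoAdmAt S n Φ⁻¹ := by
  intro j vQ B
  have himg : Φ j vQ '' (Φ⁻¹ j vQ '' B) = B := by
    change ⇑(Φ j vQ) '' (⇑((Φ j vQ).symm) '' B) = B
    rw [Set.image_image]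
    simp only [LinearEquiv.apply_symm_apply, Set.image_id']
  have hAdm : (S.D n).Adm j vQ B ↔ (S.D n).Adm j vQ (Φ⁻¹ j vQ '' B) := by
    rw [(hΦ j vQ (Φ⁻¹ j vQ '' B)).1, himg]
  refine ⟨hAdm, fun hB => ?_⟩
  have h := (hΦ j vQ (Φ⁻¹ j vQ '' B)).2 (hAdm.mp hB)
  rw [himg] at h
  exact h.symm

/-- **`⟨(Ind1)∪(Ind2)⟩ ≤ IsoAdm_n`**: under (i) (a) (`I_a_IndInvariant`: every generator preserves admissibility and log-volume at every
column) every element of the indeterminacy group is a column-`n` isometry (closure induction) — the kernel form of Step (x)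
p. 181 l. 8–12 "the resulting log-volumes ∈ ℝ are invariant with respect to the indeterminacies (Ind1), (Ind2)". [folklore] -/
theorem isoAdmAt_of_mem_closure (hIa : I_a_IndInvariant S) (n : ℤ) {Φ : S.L.PacketAut}
    (hΦ : Φ ∈ Subgroup.closure (S.L.Ind1Family ∪ S.L.Ind2Family)) : IsoAdmAt S n Φ := by
  induction hΦ using Subgroup.closure_induction with
  | mem Ψ hΨ =>
    intro j vQ B
    exact ⟨(hIa n).2 Ψ hΨ j vQ B, fun hB => (hIa n).1 Ψ hΨ j vQ B hB⟩
  | one => exact isoAdmAt_one S n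
  | mul Ψ₁ Ψ₂ _ _ ih₁ ih₂ => exact isoAdmAt_mul S ih₁ ih₂
  | inv Ψ _ ih => exact isoAdmAt_inv S ih

/-! ## 3. The iso-rung is WEAKER than the load-bearing square -/

/-- Datum form: `I_a_IndInvariant ∧ III_c_KummerLinkSquare ⟹ III_c_KummerLinkSquareIso`. [folklore] -/
theorem kummerLinkSquareIso_of_square (hIa : I_a_IndInvariant S) {n : ℤ}
    {qK : ∀ v : T.V, v ∈ T.Vbad → Set (S.L.StarPacket v)} (h : III_c_KummerLinkSquare S n qK) :
    III_c_KummerLinkSquareIso S n qK := by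
  obtain ⟨Φ, hΦ, m, hm⟩ := h
  exact ⟨Φ, isoAdmAt_of_mem_closure S hIa n hΦ, m, hm⟩

/-- Region form: under (i) (a) and the (hρ)-equivariance of the region reading inside `⟨(Ind1)∪(Ind2)⟩` (the first conjunct of the
pin `Cor312Vol.ThetaPinned`), `III_c_KummerLinkSquare ⟹ III_c_IsoTransportRegion`. [folklore] -/
theorem isoTransportRegion_of_square (hIa : I_a_IndInvariant S) {n : ℤ}
    {ρ : (∀ v : T.V, v ∈ T.Vbad → Set (S.L.StarPacket v)) → ∀ (j : T.Label) (vQ : T.VQ), Set (S.L.Packet j vQ)}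
    (hρ : ∀ Φ ∈ Subgroup.closure (S.L.Ind1Family ∪ S.L.Ind2Family),
      ∀ (Ψ : ∀ v : T.V, v ∈ T.Vbad → Set (S.L.StarPacket v)) (j : T.Label) (vQ : T.VQ),
        ρ (fun v hv => S.L.starAut Φ v '' Ψ v hv) j vQ = Φ j vQ '' ρ Ψ j vQ)
    {qK : ∀ v : T.V, v ∈ T.Vbad → Set (S.L.StarPacket v)} (h : III_c_KummerLinkSquare S n qK) :
    III_c_IsoTransportRegion S n ρ qK := by
  obtain ⟨Φ, hΦ, m, hm⟩ := h
  refine ⟨Φ, isoAdmAt_of_mem_closure S hIa n hΦ, m, fun j vQ => ?_⟩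
  have hqK : qK = fun v hv => S.L.starAut Φ v '' (S.col (n - 1)).frobΨ m v hv := funext fun v => funext fun hv => hm v hv
  rw [hqK, hρ Φ hΦ]

/-- Under the three-pin vocabulary: `Thm311Charitable_2 S P.n qK ∧ ThetaPinned S P ρ ⟹ III_c_IsoTransportRegion S P.n ρ qK` — the
typing of record implies the iso-rung at the Corollary's column (ladder step (i)). [folklore] -/
theorem isoTransportRegion_of_charitable_2 {P : Cor312.Setting S.toSituation}
    {ρ : (∀ v : T.V, v ∈ T.Vbad → Set (S.L.StarPacket v)) → ∀ (j : T.Label) (vQ : T.VQ), Set (S.L.Packet j vQ)}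
    {qK : ∀ v : T.V, v ∈ T.Vbad → Set (S.L.StarPacket v)}
    (h : Thm311Charitable_2 S P.n qK) (hΘ : ThetaPinned S P ρ) : III_c_IsoTransportRegion S P.n ρ qK :=
  isoTransportRegion_of_square S h.1.1 hΘ.1 (charitable_2_square S h).2.2

end Summit.ABC.IUTFork.Charitable.D2

end
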